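import Literature.AnabelianGeometry.EtaleTheta.SettingModelOriginProfile
import Literature.AnabelianGeometry.EtaleTheta.SettingModelCompactIndependence
import Literature.AnabelianGeometry.EtaleTheta.SettingModelIndependence
import Literature.AnabelianGeometry.EtaleTheta.SettingModelCyclotomeModEmpty
import Literature.AnabelianGeometry.EtaleTheta.SettingModelCyclotomeModTwo
import Literature.AnabelianGeometry.EtaleTheta.KummerLevelRecordsNonVacuity
import Literature.AnabelianGeometry.EtaleTheta.KummerDataOfCore
import HarnessLib

/-!
# The ROOT-MODEL PROFILE in one theorem: what `ThetaSetting.model p` satisfies and violates (proof-only)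

Mochizuki, *The étale theta function …*, Publ. RIMS **45** (2009) [EtTh], §1 pp. 12–13
[cite: MochizukiEtTh2009, §1 p.12]. PROOF-ONLY aggregation file of the abc-iut cell (prover abc-iut-w5-d125
gen 3) for the non-vacuity paragraph of the cell's adjudication record: `ThetaSetting.model p`
(abc-iut-L2-t1, `Π^tp_X = F₂ × G_{ℚ_p}` discrete, `K = ℚ_p`, `q_X = p²`) is at present the ONLY kernel
inhabitant of the [EtTh] §1 root interface `ThetaSetting p`. This file restates NOTHING: it conjoins BY NAME
the kernel certificates of abc-iut-L2-t1 (p421746), abc-iut-w5-d051 (p424726), abc-iut-w5-d028 (p425309),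
abc-iut-w5-d171 (p424679), abc-iut-w5-d047 (p427096) and abc-iut-w5-d125 (p427785, p428923, p428932) into (plus the corollary «no `KummerCore`
(abc-iut-w5-d171, p429053) at the root model»)

* `SettingModel.rootModel_profile` — ONE closed theorem: guard `IsEtThOrigin` ✓; origin clauses
  `IsThm16Origin` ✗, `IsTateOrigin` ✗; the closed-image clause hYcl ✗; `Δ_Θ` not compact ✗ but
  `(Π^tp_X)^Θ` Hausdorff ✓ and `Δ_Θ ≃* ℤ` (untwisted, discrete); Kummer data `KummerData` / `EtaleThetaData`
  EMPTY (hence no `KummerCore`); Tate-twist data `CyclotomeTower` EMPTY and `CyclotomeMod l N` EMPTY for `p² ∣ N` but INHABITED at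
  levels `1, 2`; `ThetaKummerInput` inhabited yet every Kummer class there trivial;
* `SettingModel.exists_guarded_profile` — the same as an `∃ D, D.IsEtThOrigin ∧ …` independence witness:
  none of the listed GENUINE-MODEL features follows from `ThetaSetting + IsEtThOrigin`.

HONEST FRAMING: numbers about a DEGENERATE model (consistency evidence for the typed interface), not about
[EtTh]; «empty at the toy» ≠ «vacuous in print»; nothing here asserts that abc is proved or refuted; no side
is taken on [IUTchIII] Cor. 3.12; typed ≠ proved.
-/

noncomputable section

namespace Literature.AnabelianGeometry.EtaleTheta.SettingModel

open ThetaSetting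

variable (p : ℕ) [Fact p.Prime]

/-- **The root-model profile** (one closed conjunction; every conjunct is a landed certificate cited by
name in the proof term). [cite: MochizukiEtTh2009, §1 p.12] -/
theorem rootModel_profile (l : ℕ) (hl : l ≠ 0) (E : Set ℕ+) (N : ℕ+) (hN : p ^ 2 ∣ (N : ℕ)) :
    -- guard
    (ThetaSetting.model p).IsEtThOrigin ∧
    -- origin clauses (abc-iut-w5-d051)
    ¬ (ThetaSetting.model p).IsThm16Origin ∧
    ¬ (ThetaSetting.model p).IsTateOrigin ∧
    -- closed-image clause hYcl (abc-iut-L2-t1)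
    ¬ (((ThetaSetting.model p).DtpY.map (ThetaSetting.model p).toHat.toMonoidHom).topologicalClosure ≤
        (ThetaSetting.model p).DtpY.map (ThetaSetting.model p).toHat.toMonoidHom ⊔
          (⁅⁅(ThetaSetting.model p).DeltaHat, (ThetaSetting.model p).DeltaHat⁆,
            (ThetaSetting.model p).DeltaHat⁆).topologicalClosure) ∧
    -- topology of Δ_Θ (abc-iut-w5-d028) and its exact structure (abc-iut-w5-d125)
    ¬ IsCompact ((ThetaSetting.model p).DeltaTheta : Set (ThetaSetting.model p).GtpTheta) ∧
    T2Space (ThetaSetting.model p).GtpTheta ∧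
    Nonempty ((ThetaSetting.model p).DeltaTheta ≃* Multiplicative ℤ) ∧
    -- Kummer data (abc-iut-w5-d171); hence no Kummer core (w5-d171's `KummerCore`, R78 F6) at the root model
    IsEmpty (ThetaSetting.model p).KummerData ∧
    IsEmpty (ThetaSetting.model p).EtaleThetaData ∧
    IsEmpty (ThetaSetting.model p).KummerCore ∧
    -- Tate-twist data (abc-iut-w5-d125)
    IsEmpty ((ThetaSetting.model p).CyclotomeTower l E) ∧
    IsEmpty ((ThetaSetting.model p).CyclotomeMod l N) ∧
    Nonempty ((ThetaSetting.model p).CyclotomeMod l 2) ∧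
    Nonempty ((ThetaSetting.model p).CyclotomeMod l 1) ∧
    -- Kummer-level records (abc-iut-w5-d047): inhabited, with all Kummer classes trivial
    Nonempty (ThetaSetting.model p).ThetaKummerInput ∧
    (∀ T : (ThetaSetting.model p).ThetaKummerInput, T.kummerTheta = 1 ∧ ∀ c, T.kummerConst c = 1) :=
  ⟨ThetaSetting.model_isEtThOrigin p,
    not_isThm16Origin_model p,
    model_not_isTateOrigin p,
    not_hYcl_model p,
    not_isCompact_deltaTheta_model p,
    t2Space_gtpTheta_model p,
    (exists_mulEquiv_deltaTheta_int p).elim fun e _ => ⟨e⟩,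
    ThetaSetting.model_isEmpty_kummerData p,
    ThetaSetting.model_isEmpty_etaleThetaData p,
    ⟨fun C => (ThetaSetting.model_isEmpty_kummerData p).false C.toKummerData⟩,
    isEmpty_cyclotomeTower_model p l E,
    isEmpty_cyclotomeMod_model p l N hN,
    nonempty_cyclotomeMod_two_model p l hl,
    nonempty_cyclotomeMod_one_model p l,
    thetaKummerInput_model,
    fun T => ThetaKummerInput.kummerTheta_eq_one_model T⟩

/-- **Independence witness**: one guarded `D` exhibiting every GENUINE-MODEL feature as FAILING — so none of
«origin clauses / hYcl / compact `Δ_Θ` / `Δ_Θ ≇ ℤ` / Kummer data / twist data» is a consequence of the root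
interface plus its guard. [cite: MochizukiEtTh2009, §1 p.12] -/
theorem exists_guarded_profile (l : ℕ) (E : Set ℕ+) (N : ℕ+) (hN : p ^ 2 ∣ (N : ℕ)) :
    ∃ D : ThetaSetting p, D.IsEtThOrigin ∧ ¬ D.IsThm16Origin ∧ ¬ D.IsTateOrigin ∧
      ¬ ((D.DtpY.map D.toHat.toMonoidHom).topologicalClosure ≤
          D.DtpY.map D.toHat.toMonoidHom ⊔ (⁅⁅D.DeltaHat, D.DeltaHat⁆, D.DeltaHat⁆).topologicalClosure) ∧
      ¬ IsCompact (D.DeltaTheta : Set D.GtpTheta) ∧ Nonempty (D.DeltaTheta ≃* Multiplicative ℤ) ∧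
      IsEmpty D.KummerData ∧ IsEmpty (D.CyclotomeTower l E) ∧ IsEmpty (D.CyclotomeMod l N) :=
  ⟨ThetaSetting.model p, ThetaSetting.model_isEtThOrigin p, not_isThm16Origin_model p,
    model_not_isTateOrigin p, not_hYcl_model p, not_isCompact_deltaTheta_model p,
    (exists_mulEquiv_deltaTheta_int p).elim fun e _ => ⟨e⟩, ThetaSetting.model_isEmpty_kummerData p,
    isEmpty_cyclotomeTower_model p l E, isEmpty_cyclotomeMod_model p l N hN⟩

end Literature.AnabelianGeometry.EtaleTheta.SettingModel

end
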